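import Summits.Ventures.PackingBounds.Energy.FivePointRieszThreeGramDataA2
import Summits.Ventures.PackingBounds.Energy.FivePointRieszThreeGramDataB1
import Summits.Ventures.PackingBounds.Energy.FivePointRieszThreeGramDataB2
import Summits.Ventures.PackingBounds.Energy.GramDataCheck
import HarnessLib

/-!
# The rational part of the 77 × 77 Gram block of `e3pt-sharp-n3N5s3d6K-none.json` is positive semidefinite (kernel-checked on integer data)

Framing: lottery ticket; floor = certified bounds/negative ranges. Venture `PackingBounds`, cell
`pub-packcert`, energy family E3PT (pub-packcert-energy gen 12; KERNEL-D6 data route).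

`decide +kernel` checks, in row chunks, the integer identity `S·Mp = L Lᵀ + E` with `E` symmetric (`GramData.checkRows`) and the
diagonal dominance of `E` (`GramData.checkDD`) for the data modules `FivePointRieszThreeGramDataA1/A2/B1/B2`; `GramData.psd_of_checks` then gives
`Σ_{i,j<77} (S·Mp)_{ij} y_i y_j ≥ 0` for every real `y` (applied in `FivePointRieszThreeBridge`). No polynomial identity is expanded.
-/

namespace Summit.Ventures.PackingBounds.Energy.RieszThreeD6

open Summit.Ventures.PackingBounds.Energy.GramData

set_option maxRecDepth 100000 in
/-- Rows 0–10 of `S·Mp = L Lᵀ + E`, `E` symmetric (kernel evaluation). -/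
theorem rowsQ_0_11 : checkRows 77 77 0 11 yQ lQ eQ = true := by decide +kernel

set_option maxRecDepth 100000 in
/-- Rows 11–21 of `S·Mp = L Lᵀ + E`, `E` symmetric (kernel evaluation). -/
theorem rowsQ_11_22 : checkRows 77 77 11 22 yQ lQ eQ = true := by decide +kernel

set_option maxRecDepth 100000 in
/-- Rows 22–32 of `S·Mp = L Lᵀ + E`, `E` symmetric (kernel evaluation). -/
theorem rowsQ_22_33 : checkRows 77 77 22 33 yQ lQ eQ = true := by decide +kernel

set_option maxRecDepth 100000 in
/-- Rows 33–43 of `S·Mp = L Lᵀ + E`, `E` symmetric (kernel evaluation). -/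
theorem rowsQ_33_44 : checkRows 77 77 33 44 yQ lQ eQ = true := by decide +kernel

set_option maxRecDepth 100000 in
/-- Rows 44–54 of `S·Mp = L Lᵀ + E`, `E` symmetric (kernel evaluation). -/
theorem rowsQ_44_55 : checkRows 77 77 44 55 yQ lQ eQ = true := by decide +kernel

set_option maxRecDepth 100000 in
/-- Rows 55–65 of `S·Mp = L Lᵀ + E`, `E` symmetric (kernel evaluation). -/
theorem rowsQ_55_66 : checkRows 77 77 55 66 yQ lQ eQ = true := by decide +kernel

set_option maxRecDepth 100000 in
/-- Rows 66–76 of `S·Mp = L Lᵀ + E`, `E` symmetric (kernel evaluation). -/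
theorem rowsQ_66_77 : checkRows 77 77 66 77 yQ lQ eQ = true := by decide +kernel

set_option maxRecDepth 100000 in
/-- `E` is diagonally dominant: `Σ_j |E_ij| ≤ 2 E_ii` for all rows (kernel evaluation). -/
theorem ddQ_all : checkDD 77 eQ = true := by decide +kernel

/-- All rows: `(S·Mp)_ij = Σ_c L_ic L_jc + E_ij` and `E_ij = E_ji` for `i, j < 77`. -/
theorem rowsQ_all : ∀ i j, i < 77 → j < 77 →
    ent yQ i j = dotRows lQ i j 77 + ent eQ i j ∧ ent eQ i j = ent eQ j i := by
  intro i j hi hj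
  by_cases h0 : i < 11
  · exact of_checkRows rowsQ_0_11 i j (Nat.zero_le _) h0 hj
  by_cases h1 : i < 22
  · exact of_checkRows rowsQ_11_22 i j (by omega) h1 hj
  by_cases h2 : i < 33
  · exact of_checkRows rowsQ_22_33 i j (by omega) h2 hj
  by_cases h3 : i < 44
  · exact of_checkRows rowsQ_33_44 i j (by omega) h3 hj
  by_cases h4 : i < 55
  · exact of_checkRows rowsQ_44_55 i j (by omega) h4 hj
  by_cases h5 : i < 66
  · exact of_checkRows rowsQ_55_66 i j (by omega) h5 hj
  · exact of_checkRows rowsQ_66_77 i j (by omega) hi hj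

end Summit.Ventures.PackingBounds.Energy.RieszThreeD6
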